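import Mathlib.Analysis.SpecialFunctions.Gamma.Beta
import Mathlib.MeasureTheory.Function.JacobianOneDim
import Mathlib.Analysis.SpecialFunctions.Sqrt
import Literature.Analysis.SpecialFunctions.LemniscaticEllipticValues
import Literature.Analysis.SpecialFunctions.LemniscateConstant
import HarnessLib

/-!
# Proofs: Legendre's relation at the lemniscatic modulus, `2E(1/√2)K(1/√2) − K(1/√2)² = π/2`

Topic `Literature/Analysis/SpecialFunctions`; companion ("`…Proofs`") file of
`LemniscaticEllipticValues.lean`, which vendors Lawden's statements as named facts. Here we
DISCHARGE `Lawden1989_eq_3_8_29_lemniscatic` (Lawden 1989, (3.8.29) `EK′ + E′K − KK′ = ½π` at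
`k = k′ = 1/√2`) and, on the way, `Lawden1989_eq_4_3_6` (`K(1/√2) = Γ(¼)²/(4√π)`).

## The printed proofs and the road taken

Lawden proves (3.8.29) for general modulus `0 < k < 1` by differentiating `EK′ + E′K − KK′` in `k`
((3.8.7), (3.8.12), (3.8.14) ⇒ (3.8.24)) and letting `k → 0` ((3.8.25)–(3.8.28)). Formalizing that
needs the `k`-derivatives of the complete integrals, which the tree does not have. At the
lemniscatic modulus, however, Lawden gives a second, self-contained road, which is the one typed
here (Ch. 3 Exercise 24 with its hint "put `t = cos θ` in (3.8.1) and (3.8.3)", and §4.3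
(4.3.5)–(4.3.6)): after the substitution `x = √(1 − t²)` (= `cos θ` when `x = sin θ`),

* `K(1/√2) = √2 ∫₀¹ dt/√(1 − t⁴)`, `E(1/√2) = (1/√2) ∫₀¹ (1 + t²) dt/√(1 − t⁴)`;

then `u = t⁴` turns these into Euler Beta integrals (Lawden (4.3.5):
"`4∫₀¹(1 − t⁴)^{-1/2}dt = ∫₀¹ u^{-3/4}(1 − u)^{-1/2}du = B(¼, ½)`"):

* `K = (√2/4)·B(¼,½)`, `E = (1/(4√2))·(B(¼,½) + B(¾,½))`,

so `2EK − K² = B(¼,½)B(¾,½)/8 = Γ(½)²Γ(¼)/(8Γ(5/4)) = 4π/8 = π/2`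
(`Γ(½)² = π`, `Γ(5/4) = ¼Γ(¼)`; this is Euler's 1738 identity
`∫₀¹dt/√(1−t⁴) · ∫₀¹t²dt/√(1−t⁴) = π/4`). Same computation: Whittaker–Watson §22.8;
Borwein–Borwein, *Pi and the AGM*, Thm 1.7.

## Main statements (all proved; no new definitions, no new named facts)

* `integral_Ioo_rpow_mul_one_sub_rpow`, `integrableOn_Ioo_rpow_mul_one_sub_rpow`: the real Beta
  integral over `Ioo 0 1` for exponents `a, b > 0` (from Mathlib's `Complex.betaIntegral`).
* `integral_Ioo_comp_sqrt_one_sub_sq`, `integral_Ioo_comp_rpow_quarter`: the two changes of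
  variables on `(0,1)` (Mathlib's `integral_image_eq_integral_abs_deriv_smul`; no integrability
  hypotheses needed).
* `lemniscaticK_eq_beta`, `lemniscaticE_eq_beta`: `K(1/√2)`, `E(1/√2)` in Gamma values.
* `Lawden1989_eq_3_8_29_lemniscatic_holds`: the discharge of Legendre's relation at `k = 1/√2`.
* `Lawden1989_eq_4_3_6_holds`: the discharge of (4.3.6), from `lemniscaticK_eq_beta` and the
  tree lemma `Gamma_quarter_mul_Gamma_half_div_Gamma_three_quarters` (reflection formula) of
  `LemniscateConstant.lean`.

## References

* [Lawden1989] D. F. Lawden, *Elliptic Functions and Applications*, Applied Math. Sciences 80,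
  Springer 1989: §3.8 eq. (3.8.29) (PDF p. 100), Ch. 3 Exercises 24–25 (PDF p. 110),
  §4.3 eqs. (4.3.5)–(4.3.6) (PDF p. 120).
-/

noncomputable section

open Real _root_.MeasureTheory Set

namespace Literature.Analysis.SpecialFunctions

/-! ### Euler's Beta integral over `(0,1)`, real form -/

/-- For `0 < x < 1` and real `a, b`, Mathlib's complex Beta integrand at `(a, b)` is the real
number `x^{a-1}(1-x)^{b-1}`. [folklore] -/
theorem betaIntegrand_ofReal (a b : ℝ) {x : ℝ} (hx : x ∈ Ioo (0 : ℝ) 1) :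
    (x : ℂ) ^ ((a : ℂ) - 1) * (1 - (x : ℂ)) ^ ((b : ℂ) - 1) =
      ((x ^ (a - 1) * (1 - x) ^ (b - 1) : ℝ) : ℂ) := by
  rw [show ((a : ℂ) - 1) = ((a - 1 : ℝ) : ℂ) by push_cast; ring,
    show ((b : ℂ) - 1) = ((b - 1 : ℝ) : ℂ) by push_cast; ring,
    show (1 - (x : ℂ)) = ((1 - x : ℝ) : ℂ) by push_cast; ring,
    ← Complex.ofReal_cpow hx.1.le, ← Complex.ofReal_cpow (by linarith [hx.2]), Complex.ofReal_mul]

/-- **Euler's Beta integral, real form**: for `0 < a`, `0 < b` the function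
`u ↦ u^{a-1}(1-u)^{b-1}` is integrable on `(0,1)`. [folklore] -/
theorem integrableOn_Ioo_rpow_mul_one_sub_rpow {a b : ℝ} (ha : 0 < a) (hb : 0 < b) :
    IntegrableOn (fun u : ℝ => u ^ (a - 1) * (1 - u) ^ (b - 1)) (Ioo 0 1) := by
  have hc := Complex.betaIntegral_convergent (u := a) (v := b) (by simpa) (by simpa)
  rw [intervalIntegrable_iff_integrableOn_Ioo_of_le zero_le_one] at hc
  have hre : IntegrableOn (fun x : ℝ => RCLike.re ((x : ℂ) ^ ((a : ℂ) - 1) *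
      (1 - (x : ℂ)) ^ ((b : ℂ) - 1))) (Ioo 0 1) := MeasureTheory.Integrable.re hc
  refine hre.congr_fun (fun x hx => ?_) measurableSet_Ioo
  simp only [betaIntegrand_ofReal a b hx, RCLike.re_to_complex, Complex.ofReal_re]

/-- **Euler's Beta integral, real form**: for `0 < a`, `0 < b`,
`∫_{(0,1)} u^{a-1}(1-u)^{b-1} du = B(a,b) = Γ(a)Γ(b)/Γ(a+b)` (Mathlib's
`Complex.betaIntegral_eq_Gamma_mul_div` transported to `ℝ`). [folklore] -/
theorem integral_Ioo_rpow_mul_one_sub_rpow {a b : ℝ} (ha : 0 < a) (hb : 0 < b) :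
    ∫ u in Ioo (0 : ℝ) 1, u ^ (a - 1) * (1 - u) ^ (b - 1) =
      Real.Gamma a * Real.Gamma b / Real.Gamma (a + b) := by
  have hB := Complex.betaIntegral_eq_Gamma_mul_div (a : ℂ) (b : ℂ) (by simpa) (by simpa)
  have hlhs : Complex.betaIntegral (a : ℂ) (b : ℂ) =
      ((∫ u in Ioo (0 : ℝ) 1, u ^ (a - 1) * (1 - u) ^ (b - 1) : ℝ) : ℂ) := by
    unfold Complex.betaIntegral
    rw [intervalIntegral.integral_of_le zero_le_one, integral_Ioc_eq_integral_Ioo,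
      ← integral_complex_ofReal]
    exact setIntegral_congr_fun measurableSet_Ioo (fun x hx => betaIntegrand_ofReal a b hx)
  have hrhs : Complex.Gamma (a : ℂ) * Complex.Gamma (b : ℂ) / Complex.Gamma ((a : ℂ) + (b : ℂ)) =
      ((Real.Gamma a * Real.Gamma b / Real.Gamma (a + b) : ℝ) : ℂ) := by
    rw [← Complex.ofReal_add, Complex.Gamma_ofReal, Complex.Gamma_ofReal, Complex.Gamma_ofReal]
    push_cast
    ring
  rw [hlhs, hrhs] at hB
  exact_mod_cast hB

/-! ### Two changes of variables on `(0,1)` -/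

/-- Change of variables `x = √(1 − t²)` (a decreasing diffeomorphism of `(0,1)`;
`|dx/dt| = t/√(1 − t²)`): `∫_{(0,1)} g(x) dx = ∫_{(0,1)} (t/√(1−t²)) g(√(1−t²)) dt`, for every `g`
(both sides are Bochner integrals; no integrability hypothesis). This is Lawden's hint
"put `t = cos θ`" for Ch. 3 Exercise 24, composed with `x = sin θ`. [folklore] -/
theorem integral_Ioo_comp_sqrt_one_sub_sq (g : ℝ → ℝ) :
    ∫ x in Ioo (0 : ℝ) 1, g x =
      ∫ t in Ioo (0 : ℝ) 1, t / Real.sqrt (1 - t ^ 2) * g (Real.sqrt (1 - t ^ 2)) := by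
  have himage : (fun t : ℝ => Real.sqrt (1 - t ^ 2)) '' Ioo (0 : ℝ) 1 = Ioo 0 1 := by
    ext x
    constructor
    · rintro ⟨t, ht, rfl⟩
      refine ⟨Real.sqrt_pos.mpr (by nlinarith [ht.1, ht.2]), ?_⟩
      rw [Real.sqrt_lt' one_pos]
      nlinarith [ht.1, ht.2]
    · intro hx
      refine ⟨Real.sqrt (1 - x ^ 2), ⟨Real.sqrt_pos.mpr (by nlinarith [hx.1, hx.2]), ?_⟩, ?_⟩
      · rw [Real.sqrt_lt' one_pos]
        nlinarith [hx.1, hx.2]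
      · simp only
        rw [Real.sq_sqrt (by nlinarith [hx.1, hx.2]), sub_sub_cancel, Real.sqrt_sq hx.1.le]
  have hderiv : ∀ t ∈ Ioo (0 : ℝ) 1, HasDerivWithinAt (fun t : ℝ => Real.sqrt (1 - t ^ 2))
      (-(2 * t) / (2 * Real.sqrt (1 - t ^ 2))) (Ioo 0 1) t := by
    intro t ht
    have h1 : HasDerivAt (fun t : ℝ => 1 - t ^ 2) (-(2 * t)) t := by
      simpa using (hasDerivAt_pow 2 t).const_sub 1
    exact (h1.sqrt (by nlinarith [ht.1, ht.2])).hasDerivWithinAt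
  have hinj : InjOn (fun t : ℝ => Real.sqrt (1 - t ^ 2)) (Ioo 0 1) := by
    intro a ha b hb hab
    have ha' : 0 ≤ 1 - a ^ 2 := by nlinarith [ha.1, ha.2]
    have hb' : 0 ≤ 1 - b ^ 2 := by nlinarith [hb.1, hb.2]
    have h2 : Real.sqrt (1 - a ^ 2) ^ 2 = Real.sqrt (1 - b ^ 2) ^ 2 := by
      simp only at hab
      rw [hab]
    rw [Real.sq_sqrt ha', Real.sq_sqrt hb'] at h2
    have h3 : a ^ 2 = b ^ 2 := by linarith
    exact (pow_left_inj₀ ha.1.le hb.1.le two_ne_zero).mp h3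
  have key := integral_image_eq_integral_abs_deriv_smul measurableSet_Ioo hderiv hinj g
  rw [himage] at key
  rw [key]
  refine setIntegral_congr_fun measurableSet_Ioo (fun t ht => ?_)
  have hs : 0 < Real.sqrt (1 - t ^ 2) := Real.sqrt_pos.mpr (by nlinarith [ht.1, ht.2])
  simp only [smul_eq_mul]
  rw [show -(2 * t) / (2 * Real.sqrt (1 - t ^ 2)) = -(t / Real.sqrt (1 - t ^ 2)) by
      field_simp, abs_neg, abs_of_pos (div_pos ht.1 hs)]

/-- Change of variables `t = u^{1/4}` (an increasing diffeomorphism of `(0,1)`;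
`dt/du = ¼u^{-3/4}`): `∫_{(0,1)} g(t) dt = ∫_{(0,1)} ¼u^{-3/4} g(u^{1/4}) du`, for every `g` — the
substitution `u = t⁴` of Lawden (4.3.5). [folklore] -/
theorem integral_Ioo_comp_rpow_quarter (g : ℝ → ℝ) :
    ∫ t in Ioo (0 : ℝ) 1, g t =
      ∫ u in Ioo (0 : ℝ) 1, 1 / 4 * u ^ (-(3 / 4 : ℝ)) * g (u ^ (1 / 4 : ℝ)) := by
  have himage : (fun u : ℝ => u ^ (1 / 4 : ℝ)) '' Ioo (0 : ℝ) 1 = Ioo 0 1 := by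
    ext t
    constructor
    · rintro ⟨u, hu, rfl⟩
      exact ⟨Real.rpow_pos_of_pos hu.1 _, Real.rpow_lt_one hu.1.le hu.2 (by norm_num)⟩
    · intro ht
      refine ⟨t ^ (4 : ℝ), ⟨Real.rpow_pos_of_pos ht.1 _, Real.rpow_lt_one ht.1.le ht.2 (by norm_num)⟩,
        ?_⟩
      simp only
      rw [← Real.rpow_mul ht.1.le]
      norm_num
  have hderiv : ∀ u ∈ Ioo (0 : ℝ) 1, HasDerivWithinAt (fun u : ℝ => u ^ (1 / 4 : ℝ))
      (1 / 4 * u ^ (1 / 4 - 1 : ℝ)) (Ioo 0 1) u := fun u hu =>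
    (Real.hasDerivAt_rpow_const (Or.inl hu.1.ne')).hasDerivWithinAt
  have hinj : InjOn (fun u : ℝ => u ^ (1 / 4 : ℝ)) (Ioo 0 1) :=
    (Real.rpow_left_injOn (by norm_num : (1 / 4 : ℝ) ≠ 0)).mono fun u hu => hu.1.le
  have key := integral_image_eq_integral_abs_deriv_smul measurableSet_Ioo hderiv hinj g
  rw [himage] at key
  rw [key]
  refine setIntegral_congr_fun measurableSet_Ioo (fun u hu => ?_)
  have hpos : 0 < 1 / 4 * u ^ (1 / 4 - 1 : ℝ) := by
    have := Real.rpow_pos_of_pos hu.1 (1 / 4 - 1 : ℝ)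
    positivity
  simp only [smul_eq_mul]
  rw [abs_of_pos hpos, show (1 / 4 - 1 : ℝ) = -(3 / 4 : ℝ) by norm_num]

/-! ### The two pointwise identities behind each substitution -/

/-- After `x = √(1 − t²)`, the `K(1/√2)` integrand becomes `√2/√(1 − t⁴)` (`0 < t < 1`).
[cite: Lawden1989, §4.3 eqs. (4.3.2)–(4.3.6)] -/
theorem lemniscaticK_subst_sqrt {t : ℝ} (ht : t ∈ Ioo (0 : ℝ) 1) :
    t / Real.sqrt (1 - t ^ 2) *
        (1 / Real.sqrt ((1 - Real.sqrt (1 - t ^ 2) ^ 2) * (1 - Real.sqrt (1 - t ^ 2) ^ 2 / 2))) =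
      Real.sqrt 2 / Real.sqrt (1 - t ^ 4) := by
  obtain ⟨ht0, ht1⟩ := ht
  have hp2 : 0 < 1 - t ^ 2 := by nlinarith
  have hq2 : 0 < 1 + t ^ 2 := by positivity
  have hp : 0 < Real.sqrt (1 - t ^ 2) := Real.sqrt_pos.mpr hp2
  have hq : 0 < Real.sqrt (1 + t ^ 2) := Real.sqrt_pos.mpr hq2
  have hr : 0 < Real.sqrt 2 := Real.sqrt_pos.mpr two_pos
  have hpp : Real.sqrt (1 - t ^ 2) ^ 2 = 1 - t ^ 2 := Real.sq_sqrt hp2.le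
  have h1 : Real.sqrt ((1 - Real.sqrt (1 - t ^ 2) ^ 2) * (1 - Real.sqrt (1 - t ^ 2) ^ 2 / 2)) =
      t * (Real.sqrt (1 + t ^ 2) / Real.sqrt 2) := by
    rw [hpp, show (1 - (1 - t ^ 2)) * (1 - (1 - t ^ 2) / 2) = t ^ 2 * ((1 + t ^ 2) / 2) by ring,
      Real.sqrt_mul (sq_nonneg t), Real.sqrt_sq ht0.le, Real.sqrt_div hq2.le]
  have h2 : Real.sqrt (1 - t ^ 4) = Real.sqrt (1 - t ^ 2) * Real.sqrt (1 + t ^ 2) := by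
    rw [show (1 : ℝ) - t ^ 4 = (1 - t ^ 2) * (1 + t ^ 2) by ring, Real.sqrt_mul hp2.le]
  rw [h1, h2]
  field_simp

/-- After `x = √(1 − t²)`, the `E(1/√2)` integrand becomes `(1 + t²)/(√2·√(1 − t⁴))`
(`0 < t < 1`). [cite: Lawden1989, Ch. 3 Exercise 24 (hint)] -/
theorem lemniscaticE_subst_sqrt {t : ℝ} (ht : t ∈ Ioo (0 : ℝ) 1) :
    t / Real.sqrt (1 - t ^ 2) *
        (Real.sqrt (1 - Real.sqrt (1 - t ^ 2) ^ 2 / 2) / Real.sqrt (1 - Real.sqrt (1 - t ^ 2) ^ 2)) =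
      (1 + t ^ 2) / (Real.sqrt 2 * Real.sqrt (1 - t ^ 4)) := by
  obtain ⟨ht0, ht1⟩ := ht
  have hp2 : 0 < 1 - t ^ 2 := by nlinarith
  have hq2 : 0 < 1 + t ^ 2 := by positivity
  have hp : 0 < Real.sqrt (1 - t ^ 2) := Real.sqrt_pos.mpr hp2
  have hq : 0 < Real.sqrt (1 + t ^ 2) := Real.sqrt_pos.mpr hq2
  have hr : 0 < Real.sqrt 2 := Real.sqrt_pos.mpr two_pos
  have hpp : Real.sqrt (1 - t ^ 2) ^ 2 = 1 - t ^ 2 := Real.sq_sqrt hp2.le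
  have hqq : Real.sqrt (1 + t ^ 2) ^ 2 = 1 + t ^ 2 := Real.sq_sqrt hq2.le
  -- replace the bare `1 + t²` by `√(1+t²)²` before `√(1+t²)` shows up elsewhere
  rw [← hqq]
  have h1 : Real.sqrt (1 - Real.sqrt (1 - t ^ 2) ^ 2 / 2) = Real.sqrt (1 + t ^ 2) / Real.sqrt 2 := by
    rw [hpp, show 1 - (1 - t ^ 2) / 2 = (1 + t ^ 2) / 2 by ring, Real.sqrt_div hq2.le]
  have h2 : Real.sqrt (1 - Real.sqrt (1 - t ^ 2) ^ 2) = t := by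
    rw [hpp, sub_sub_cancel, Real.sqrt_sq ht0.le]
  have h3 : Real.sqrt (1 - t ^ 4) = Real.sqrt (1 - t ^ 2) * Real.sqrt (1 + t ^ 2) := by
    rw [show (1 : ℝ) - t ^ 4 = (1 - t ^ 2) * (1 + t ^ 2) by ring, Real.sqrt_mul hp2.le]
  rw [h1, h2, h3]
  field_simp

/-- After `t = u^{1/4}`, `¼u^{-3/4}·√2/√(1 − t⁴)` is `(√2/4)·u^{1/4-1}(1 − u)^{1/2-1}` (`0 < u < 1`):
the Beta integrand `B(¼, ½)` of Lawden (4.3.5). [cite: Lawden1989, §4.3 eq. (4.3.5)] -/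
theorem lemniscaticK_subst_rpow {u : ℝ} (hu : u ∈ Ioo (0 : ℝ) 1) :
    1 / 4 * u ^ (-(3 / 4 : ℝ)) * (Real.sqrt 2 / Real.sqrt (1 - (u ^ (1 / 4 : ℝ)) ^ 4)) =
      Real.sqrt 2 / 4 * (u ^ (1 / 4 - 1 : ℝ) * (1 - u) ^ (1 / 2 - 1 : ℝ)) := by
  have hu0 : 0 < u := hu.1
  have h4 : (u ^ (1 / 4 : ℝ)) ^ 4 = u := by
    rw [← Real.rpow_natCast, ← Real.rpow_mul hu0.le]
    norm_num
  rw [h4, show (1 / 4 - 1 : ℝ) = -(3 / 4) by norm_num, show (1 / 2 - 1 : ℝ) = -(1 / 2) by norm_num,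
    Real.rpow_neg (by linarith [hu.2] : (0 : ℝ) ≤ 1 - u) (1 / 2), ← Real.sqrt_eq_rpow (1 - u)]
  ring

/-- After `t = u^{1/4}`, `¼u^{-3/4}·(1 + t²)/(√2√(1 − t⁴))` is
`(1/(4√2))·(u^{1/4-1}(1−u)^{1/2-1} + u^{3/4-1}(1−u)^{1/2-1})` (`0 < u < 1`): the sum of the Beta
integrands of `B(¼,½)` and `B(¾,½)`. [cite: Lawden1989, Ch. 3 Exercise 24 (hint)] -/
theorem lemniscaticE_subst_rpow {u : ℝ} (hu : u ∈ Ioo (0 : ℝ) 1) :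
    1 / 4 * u ^ (-(3 / 4 : ℝ)) *
        ((1 + (u ^ (1 / 4 : ℝ)) ^ 2) / (Real.sqrt 2 * Real.sqrt (1 - (u ^ (1 / 4 : ℝ)) ^ 4))) =
      1 / (4 * Real.sqrt 2) *
        (u ^ (1 / 4 - 1 : ℝ) * (1 - u) ^ (1 / 2 - 1 : ℝ) +
          u ^ (3 / 4 - 1 : ℝ) * (1 - u) ^ (1 / 2 - 1 : ℝ)) := by
  have hu0 : 0 < u := hu.1
  have h4 : (u ^ (1 / 4 : ℝ)) ^ 4 = u := by
    rw [← Real.rpow_natCast, ← Real.rpow_mul hu0.le]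
    norm_num
  have h2 : (u ^ (1 / 4 : ℝ)) ^ 2 = u ^ (1 / 2 : ℝ) := by
    rw [← Real.rpow_natCast, ← Real.rpow_mul hu0.le]
    norm_num
  have h34 : u ^ (3 / 4 - 1 : ℝ) = u ^ (-(3 / 4) : ℝ) * u ^ (1 / 2 : ℝ) := by
    rw [← Real.rpow_add hu0]
    norm_num
  rw [h4, h2, h34, show (1 / 4 - 1 : ℝ) = -(3 / 4) by norm_num,
    show (1 / 2 - 1 : ℝ) = -(1 / 2) by norm_num,
    Real.rpow_neg (by linarith [hu.2] : (0 : ℝ) ≤ 1 - u) (1 / 2), ← Real.sqrt_eq_rpow (1 - u)]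
  have hs2 : Real.sqrt 2 ≠ 0 := by positivity
  have hs1 : Real.sqrt (1 - u) ≠ 0 := (Real.sqrt_pos.mpr (by linarith [hu.2])).ne'
  field_simp

/-! ### `K(1/√2)` and `E(1/√2)` as Beta values -/

/-- **Lawden (4.3.5)–(4.3.6), Beta form**: `K(1/√2) = (√2/4)·B(¼,½) = (√2/4)·Γ(¼)Γ(½)/Γ(¾)`.
[cite: Lawden1989, §4.3 eqs. (4.3.5)–(4.3.6)] -/
theorem lemniscaticK_eq_beta :
    lemniscaticK = Real.sqrt 2 / 4 * (Real.Gamma (1 / 4) * Real.Gamma (1 / 2) / Real.Gamma (3 / 4)) := by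
  calc lemniscaticK
      = ∫ t in Ioo (0 : ℝ) 1, t / Real.sqrt (1 - t ^ 2) *
          (1 / Real.sqrt ((1 - Real.sqrt (1 - t ^ 2) ^ 2) * (1 - Real.sqrt (1 - t ^ 2) ^ 2 / 2))) := by
        unfold lemniscaticK
        exact integral_Ioo_comp_sqrt_one_sub_sq _
    _ = ∫ t in Ioo (0 : ℝ) 1, Real.sqrt 2 / Real.sqrt (1 - t ^ 4) :=
        setIntegral_congr_fun measurableSet_Ioo fun t ht => lemniscaticK_subst_sqrt ht
    _ = ∫ u in Ioo (0 : ℝ) 1, 1 / 4 * u ^ (-(3 / 4 : ℝ)) *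
          (Real.sqrt 2 / Real.sqrt (1 - (u ^ (1 / 4 : ℝ)) ^ 4)) :=
        integral_Ioo_comp_rpow_quarter _
    _ = ∫ u in Ioo (0 : ℝ) 1, Real.sqrt 2 / 4 * (u ^ (1 / 4 - 1 : ℝ) * (1 - u) ^ (1 / 2 - 1 : ℝ)) :=
        setIntegral_congr_fun measurableSet_Ioo fun u hu => lemniscaticK_subst_rpow hu
    _ = Real.sqrt 2 / 4 *
          (Real.Gamma (1 / 4) * Real.Gamma (1 / 2) / Real.Gamma (1 / 4 + 1 / 2)) := by
        rw [integral_const_mul, integral_Ioo_rpow_mul_one_sub_rpow (a := 1 / 4) (b := 1 / 2)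
          (by norm_num) (by norm_num)]
    _ = Real.sqrt 2 / 4 * (Real.Gamma (1 / 4) * Real.Gamma (1 / 2) / Real.Gamma (3 / 4)) := by
        norm_num

/-- **Lawden Ch. 3 Exercise 24, Beta form**:
`E(1/√2) = (1/(4√2))·(B(¼,½) + B(¾,½)) = (1/(4√2))·(Γ(¼)Γ(½)/Γ(¾) + Γ(¾)Γ(½)/Γ(5/4))`.
[cite: Lawden1989, Ch. 3 Exercise 24] -/
theorem lemniscaticE_eq_beta :
    lemniscaticE = 1 / (4 * Real.sqrt 2) *
      (Real.Gamma (1 / 4) * Real.Gamma (1 / 2) / Real.Gamma (3 / 4) +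
        Real.Gamma (3 / 4) * Real.Gamma (1 / 2) / Real.Gamma (5 / 4)) := by
  have hI1 := integrableOn_Ioo_rpow_mul_one_sub_rpow (a := 1 / 4) (b := 1 / 2)
    (by norm_num) (by norm_num)
  have hI2 := integrableOn_Ioo_rpow_mul_one_sub_rpow (a := 3 / 4) (b := 1 / 2)
    (by norm_num) (by norm_num)
  calc lemniscaticE
      = ∫ t in Ioo (0 : ℝ) 1, t / Real.sqrt (1 - t ^ 2) *
          (Real.sqrt (1 - Real.sqrt (1 - t ^ 2) ^ 2 / 2) /
            Real.sqrt (1 - Real.sqrt (1 - t ^ 2) ^ 2)) := by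
        unfold lemniscaticE
        exact integral_Ioo_comp_sqrt_one_sub_sq _
    _ = ∫ t in Ioo (0 : ℝ) 1, (1 + t ^ 2) / (Real.sqrt 2 * Real.sqrt (1 - t ^ 4)) :=
        setIntegral_congr_fun measurableSet_Ioo fun t ht => lemniscaticE_subst_sqrt ht
    _ = ∫ u in Ioo (0 : ℝ) 1, 1 / 4 * u ^ (-(3 / 4 : ℝ)) *
          ((1 + (u ^ (1 / 4 : ℝ)) ^ 2) / (Real.sqrt 2 * Real.sqrt (1 - (u ^ (1 / 4 : ℝ)) ^ 4))) :=
        integral_Ioo_comp_rpow_quarter _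
    _ = ∫ u in Ioo (0 : ℝ) 1, 1 / (4 * Real.sqrt 2) *
          (u ^ (1 / 4 - 1 : ℝ) * (1 - u) ^ (1 / 2 - 1 : ℝ) +
            u ^ (3 / 4 - 1 : ℝ) * (1 - u) ^ (1 / 2 - 1 : ℝ)) :=
        setIntegral_congr_fun measurableSet_Ioo fun u hu => lemniscaticE_subst_rpow hu
    _ = 1 / (4 * Real.sqrt 2) *
          (Real.Gamma (1 / 4) * Real.Gamma (1 / 2) / Real.Gamma (1 / 4 + 1 / 2) +
            Real.Gamma (3 / 4) * Real.Gamma (1 / 2) / Real.Gamma (3 / 4 + 1 / 2)) := by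
        rw [integral_const_mul, integral_add hI1 hI2,
          integral_Ioo_rpow_mul_one_sub_rpow (a := 1 / 4) (b := 1 / 2) (by norm_num) (by norm_num),
          integral_Ioo_rpow_mul_one_sub_rpow (a := 3 / 4) (b := 1 / 2) (by norm_num) (by norm_num)]
    _ = _ := by norm_num

/-! ### The discharge -/

/-- **Legendre's relation at the lemniscatic modulus** (Lawden 1989, (3.8.29) at `k = k′ = 1/√2`,
where `K′ = K`, `E′ = E` by Ch. 3 Exercise 25): `2·E(1/√2)·K(1/√2) − K(1/√2)² = π/2` — DISCHARGE
of the named fact `Lawden1989_eq_3_8_29_lemniscatic`. Proof by the Beta evaluations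
`lemniscaticK_eq_beta`, `lemniscaticE_eq_beta` (Lawden §4.3 / Ex. 24 road, not the
`k`-differentiation proof (3.8.24)–(3.8.28)): `2EK − K² = B(¼,½)B(¾,½)/8 = π/2` using
`Γ(½) = √π` and `Γ(5/4) = ¼Γ(¼)`.
[cite: Lawden1989, §3.8 eq. (3.8.29), Ch. 3 Exercises 24–25, §4.3 eq. (4.3.6)] -/
theorem Lawden1989_eq_3_8_29_lemniscatic_holds : Lawden1989_eq_3_8_29_lemniscatic := by
  unfold Lawden1989_eq_3_8_29_lemniscatic
  rw [lemniscaticE_eq_beta, lemniscaticK_eq_beta, Real.Gamma_one_half_eq]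
  have h54 : Real.Gamma (5 / 4) = 1 / 4 * Real.Gamma (1 / 4) := by
    rw [show (5 / 4 : ℝ) = 1 / 4 + 1 by norm_num, Real.Gamma_add_one (by norm_num)]
  rw [h54]
  have h14 : Real.Gamma (1 / 4) ≠ 0 := (Real.Gamma_pos_of_pos (by norm_num)).ne'
  have h34 : Real.Gamma (3 / 4) ≠ 0 := (Real.Gamma_pos_of_pos (by norm_num)).ne'
  have hs2 : Real.sqrt 2 ≠ 0 := by positivity
  have hs2sq : Real.sqrt 2 ^ 2 = 2 := Real.sq_sqrt two_pos.le
  have hsπ : Real.sqrt π ^ 2 = π := Real.sq_sqrt Real.pi_pos.le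
  field_simp
  ring_nf
  rw [hs2sq, hsπ]
  ring

/-- **Lawden 1989, eq. (4.3.6)** (= Ch. 3 Exercise 24, first half): `K(1/√2) = ¼π^{-1/2}Γ(¼)²`,
i.e. `∫₀¹ dt/√((1 − t²)(1 − t²/2)) = Γ(1/4)²/(4√π)` — DISCHARGE of the named fact
`Lawden1989_eq_4_3_6`, from the Beta form `lemniscaticK_eq_beta` ((4.3.5)) and
`Γ(¼)Γ(½)/Γ(¾) = Γ(¼)²/√(2π)` (`Γ(½) = √π` and the reflection formula
`Γ(¼)Γ(¾) = π/sin(π/4) = π√2`, tree lemma `Gamma_quarter_mul_Gamma_half_div_Gamma_three_quarters`).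
[cite: Lawden1989, §4.3 eqs. (4.3.5)–(4.3.6) and Ch. 3 Exercise 24] -/
theorem Lawden1989_eq_4_3_6_holds : Lawden1989_eq_4_3_6 := by
  unfold Lawden1989_eq_4_3_6
  rw [lemniscaticK_eq_beta, Gamma_quarter_mul_Gamma_half_div_Gamma_three_quarters,
    Real.sqrt_mul' _ Real.pi_pos.le]
  have hs2 : Real.sqrt 2 ≠ 0 := by positivity
  have hsπ : Real.sqrt π ≠ 0 := by positivity
  field_simp

end Literature.Analysis.SpecialFunctions

end
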